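import Mathlib

/-!
# `Balaban1983to89.B12Eq416DerivB` — T. Bałaban, *Renormalization group approach to lattice gauge field
theories. I*, Commun. Math. Phys. **109** (1987) 249–301 [Balaban1987RG1]: (4.16) p. 285, the formula for the
unit-lattice derivative `∂_νB_μ` of the localized field `B_μ(x) = ζ̃_□(x)Q_{j,μ}(ηA, x)`, PROVED as an identity, and
the first-derivative bound (4.17) reduced to its printed inputs

HONEST FRAMING (cell `lit-balaban`, verbatim): statement-level skeleton of published theorems with citation tags; proofs where landed; nothing here is a claim about the Yang–Mills mass gap.

PDF held: `paper:balaban1987-cmp109-rg-i-small-field` (journal page = PDF page + 248); read from the page renders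
`b2b-balaban-ref1/pages/1987-cmp109-rg-I-small-field/…-p036-x2.png` (p. 284), `…-p037-x2.png` (p. 285) and
`…-p029-x2.png` (p. 277, (3.32)).

WHAT IS REPRODUCED.  SKELETON row `B12.Eq4.16-4.18` (absent before this file; r09: «statements typeable; proof
needs B7 Prop 5 + (3.32)»).  THE PRINT, verbatim, p. 284 l. −2 – p. 285: *«The field
B_μ(x) = B(x, x+e_μ) = ζ̃_□(x)Q_j(ηA, ⟨x, x+e_μ⟩) = ζ̃_□(x)Q_{j,μ}(ηA, x) is defined on the unit lattice T₁^{(j)}. The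
operation Q_{j,μ} is translation invariant, i.e., Q_{j,μ}(ηA, x+a) = Q_{j,μ}(ηt_aA, x), where (t_aA_ν)(x) = A_ν(x+a),
a ∈ T₁^{(j)}, hence we have the following formula for the derivative ∂_νB_μ
  (∂_νB_μ)(x) = ζ̃_□(x+e_ν)Q_{j,μ}(ηA, x+e_ν) − ζ̃_□(x)Q_{j,μ}(ηA, x)
     = Σ_{b⊂[x,x+e_ν]} ξ(∂^ξζ̃_□)(b)Q_{j,μ}(ηA, x+e_ν) + ζ̃_□(x)∫₀¹dt ⟨(δ/δA)Q_{j,μ}(ηA + ηt(t_{e_ν}A − A)), η(t_{e_ν}A − A)⟩,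
  where x ∈ T₁^{(j)}, and for x′ ∈ T_ξ,  (t_{e_ν}A − A)_λ(x′) = Σ_{b⊂[x′,x′+e_ν]} ξ(∂^ξA_λ)(b). (4.16)
The field A is regular on η-lattice, it satisfies the bounds (3.32), hence the derivative ∂^ξA_λ can be bounded by
O(1)L^jη. The same remark applies to the derivative ∂^ξζ̃_□. More precisely, (3.32) and Proposition 5 [7] on
functional derivatives of averaging operations imply  |(∂_νB_μ)(x)| < O(1)(α₂ + B₃O(1)Mα₀)(L^jη)² < α₁(L^jη)². (4.17)
… For second order derivatives we have a weaker conclusion … |(∂_λ∂_νB_μ)(x)| < α₁(L^jη)^{2+β}, 0 ≦ β ≦ β₀ < 1, (4.18)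
by similar considerations as in the proof of (4.17). The inequalities (4.17), (4.18) hold for the field δB also.»*

THE TYPING (cell DIVERGENCE rows for this file).  (a) The two lattices along one direction is all (4.16) uses: the
fine torus `T_ξ` is modelled by `Fin d → ZMod N` (integer coordinates in units of `ξ`), the unit step `e_ν` by
`n = ξ⁻¹` fine steps (`unitStep n ν = n • 1_ν`; in print `n = L^j`), the bonds `b ⊂ [x, x+e_ν]` by
`m ∈ range n` (`segPt x ν m → segPt x ν (m+1)`), and `ξ(∂^ξφ)(b) = φ(b₊) − φ(b₋)` (`dxi`).  (b) Fields
`A : T_ξ → (Fin d → 𝔤)` form the finite-dimensional normed space `Fld` (sup norm); `(t_aA)(x′) = A(x′ + a)`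
(`transl`); `Q = Q_{j,μ} : Fld → T_ξ → 𝔤` is an arbitrary map, of class `C¹` in the field on an open set containing
the segment `{ηA + tη(t_{e_ν}A − A)}` and translation invariant for the unit step (hypotheses `hQ`, `htransl`);
`⟨(δ/δA)Q, ·⟩` = the Fréchet derivative `fderiv ℝ`; `ζ̃_□ : T_ξ → ℝ` arbitrary (its profile is r09's
`B12PartitionUnity270`).  (c) `eq416` = (4.16) first display PROVED (product rule, telescoping `sub_eq_sum_xi_dxi`,
translation invariance, the fundamental theorem of calculus along the segment `ftc_segment`); `eq416_transl` = its
last display PROVED.  (d) (4.17) is typed as the ARITHMETIC it asserts (`norm_dB_le`): the four printed inputs — the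
total `ξ`-variation of `ζ̃_□` along the segment, the size of `Q_{j,μ}(ηA)`, the operator norm of `(δ/δA)Q_{j,μ}`
(*«Proposition 5 [7] on functional derivatives of averaging operations»*) and the size of `η(t_{e_ν}A − A)` (from
(3.32) via `eq416_transl`) — enter as NAMED hypotheses with free constants; the identification of their product/sum
with the printed `O(1)(α₂ + B₃O(1)Mα₀)(L^jη)²` is the paper's bookkeeping of §3 and is NOT re-derived here.
NOT TYPED: (4.18) (second differences, Hölder norms — *«by similar considerations»*), the lattice formulas of
`Q_{j,μ}` and `ζ̃_□`.  No `Prop` placeholder, no new fact; axioms standard.  Unit `lit-balaban-p07` (Phase-2 seat p07,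
claim 2026-08-21T00:58Z), HOME `run/shared/lean/pub/lit-balaban/`.
-/

namespace Literature.MathematicalPhysics.QuantumFieldTheory.Balaban1983to89.B12Eq416DerivB

open _root_.Finset _root_.Set _root_.MeasureTheory intervalIntegral

noncomputable section

/-! ## §1. The segment `[x, x+e_ν]` of the fine lattice and the telescoping identity -/

section Lattice

variable {d N : ℕ}

/-- The fine step `ξe_ν` of `T_ξ` (coordinates in units of `ξ`). [folklore] -/
def fineStep (ν : Fin d) : Fin d → ZMod N := Pi.single ν 1

/-- The unit step `e_ν = n·(ξe_ν)` of `T₁^{(j)} ⊂ T_ξ`, `n = ξ⁻¹` (`= L^j` in print).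
[cite: Balaban1987RG1, (4.16) p.285] -/
def unitStep (n : ℕ) (ν : Fin d) : Fin d → ZMod N := n • fineStep ν

/-- The `m`-th point `x + mξe_ν` of the segment `[x, x+e_ν]`; its bonds are `b_m = ⟨segPt m, segPt (m+1)⟩`,
`m < n`. [cite: Balaban1987RG1, (4.16) p.285] -/
def segPt (x : Fin d → ZMod N) (ν : Fin d) (m : ℕ) : Fin d → ZMod N := x + m • fineStep ν

/-- [folklore] -/
private theorem segPt_zero (x : Fin d → ZMod N) (ν : Fin d) : segPt x ν 0 = x := by
  simp [segPt]

/-- [folklore] -/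
private theorem segPt_end (x : Fin d → ZMod N) (ν : Fin d) (n : ℕ) : segPt x ν n = x + unitStep n ν := rfl

variable {M : Type*} [AddCommGroup M]

/-- Telescoping along the segment: `φ(x+e_ν) − φ(x) = Σ_{m<n} [φ(x+(m+1)ξe_ν) − φ(x+mξe_ν)]`. [folklore] -/
private theorem sub_eq_sum_range (φ : (Fin d → ZMod N) → M) (x : Fin d → ZMod N) (ν : Fin d) (n : ℕ) :
    φ (x + unitStep n ν) - φ x = ∑ m ∈ range n, (φ (segPt x ν (m + 1)) - φ (segPt x ν m)) := by
  rw [Finset.sum_range_sub (fun m => φ (segPt x ν m)) n, segPt_end, segPt_zero]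

variable [Module ℝ M]

/-- `(∂^ξφ)(b_m) = ξ⁻¹[φ(b_{m,+}) − φ(b_{m,−})]`, the `ξ`-lattice derivative on the `m`-th bond of `[x, x+e_ν]`.
[cite: Balaban1987RG1, (4.16) p.285] -/
def dxi (ξ : ℝ) (φ : (Fin d → ZMod N) → M) (x : Fin d → ZMod N) (ν : Fin d) (m : ℕ) : M :=
  ξ⁻¹ • (φ (segPt x ν (m + 1)) - φ (segPt x ν m))

/-- `ξ(∂^ξφ)(b) = φ(b₊) − φ(b₋)`. [folklore] -/
private theorem xi_smul_dxi {ξ : ℝ} (hξ : ξ ≠ 0) (φ : (Fin d → ZMod N) → M) (x : Fin d → ZMod N) (ν : Fin d)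
    (m : ℕ) : ξ • dxi ξ φ x ν m = φ (segPt x ν (m + 1)) - φ (segPt x ν m) := by
  rw [dxi, smul_smul, mul_inv_cancel₀ hξ, one_smul]

/-- **Telescoping in the printed form**: `φ(x+e_ν) − φ(x) = Σ_{b⊂[x,x+e_ν]} ξ(∂^ξφ)(b)`.
[cite: Balaban1987RG1, (4.16) p.285] -/
theorem sub_eq_sum_xi_dxi {ξ : ℝ} (hξ : ξ ≠ 0) (φ : (Fin d → ZMod N) → M) (x : Fin d → ZMod N)
    (ν : Fin d) (n : ℕ) : φ (x + unitStep n ν) - φ x = ∑ m ∈ range n, ξ • dxi ξ φ x ν m := by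
  simp_rw [xi_smul_dxi hξ]
  exact sub_eq_sum_range φ x ν n

/-- The translation `(t_aA)(x′) = A(x′ + a)` of a field on `T_ξ`. [cite: Balaban1987RG1, (4.16) p.285] -/
def transl {V : Type*} (a : Fin d → ZMod N) (A : (Fin d → ZMod N) → V) : (Fin d → ZMod N) → V :=
  fun x' => A (x' + a)

/-- **(4.16), last display**: *«for x′ ∈ T_ξ, (t_{e_ν}A − A)_λ(x′) = Σ_{b⊂[x′,x′+e_ν]} ξ(∂^ξA_λ)(b)»* (all
components `λ` at once: `M = Fin d → 𝔤`). [cite: Balaban1987RG1, (4.16) p.285] -/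
theorem eq416_transl {ξ : ℝ} (hξ : ξ ≠ 0) (A : (Fin d → ZMod N) → M) (x' : Fin d → ZMod N) (ν : Fin d)
    (n : ℕ) : (transl (unitStep n ν) A - A) x' = ∑ m ∈ range n, ξ • dxi ξ A x' ν m := by
  rw [Pi.sub_apply, transl]
  exact sub_eq_sum_xi_dxi hξ A x' ν n

end Lattice

/-! ## §2. The fundamental theorem of calculus along a segment of field space -/

section FTC

variable {E F : Type*} [NormedAddCommGroup E] [NormedSpace ℝ E] [NormedAddCommGroup F] [NormedSpace ℝ F]
  [CompleteSpace F]

/-- `f(p + v) − f(p) = ∫₀¹ dt ⟨Df(p + tv), v⟩` for `f` of class `C¹` on an open set containing the segment. [folklore] -/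
private theorem ftc_segment {s : Set E} (hs : IsOpen s) {f : E → F} (hf : ContDiffOn ℝ 1 f s) (p v : E)
    (hseg : ∀ t ∈ Icc (0 : ℝ) 1, p + t • v ∈ s) :
    f (p + v) - f p = ∫ t in (0 : ℝ)..1, fderiv ℝ f (p + t • v) v := by
  have hγ : ∀ t : ℝ, HasDerivAt (fun τ : ℝ => p + τ • v) v t := fun t => by
    simpa using ((hasDerivAt_id t).smul_const v).const_add p
  have hdiff : ∀ t ∈ Icc (0 : ℝ) 1, DifferentiableAt ℝ f (p + t • v) := fun t ht =>
    (hf.differentiableOn one_ne_zero).differentiableAt (hs.mem_nhds (hseg t ht))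
  have hderiv : ∀ t ∈ uIcc (0 : ℝ) 1,
      HasDerivAt (fun τ : ℝ => f (p + τ • v)) (fderiv ℝ f (p + t • v) v) t := by
    intro t ht
    rw [Set.uIcc_of_le zero_le_one] at ht
    exact (hdiff t ht).hasFDerivAt.comp_hasDerivAt t (hγ t)
  have hcont : ContinuousOn (fun t : ℝ => fderiv ℝ f (p + t • v) v) (Icc (0 : ℝ) 1) := by
    have hD : ContinuousOn (fderiv ℝ f) s := hf.continuousOn_fderiv_of_isOpen hs le_rfl
    have hray : ContinuousOn (fun t : ℝ => p + t • v) (Icc (0 : ℝ) 1) :=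
      (continuous_const.add (continuous_id.smul continuous_const)).continuousOn
    have hcomp : ContinuousOn (fun t : ℝ => fderiv ℝ f (p + t • v)) (Icc (0 : ℝ) 1) :=
      hD.comp hray fun t ht => hseg t ht
    exact (ContinuousLinearMap.apply ℝ F v).continuous.comp_continuousOn hcomp
  have hint : IntervalIntegrable (fun t : ℝ => fderiv ℝ f (p + t • v) v) volume 0 1 := by
    refine ContinuousOn.intervalIntegrable ?_
    rw [Set.uIcc_of_le zero_le_one]
    exact hcont
  have h := intervalIntegral.integral_eq_sub_of_hasDerivAt hderiv hint
  simp only [one_smul, zero_smul, add_zero] at h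
  exact h.symm

end FTC

/-! ## §3. (4.16): the derivative `∂_νB_μ` of `B_μ(x) = ζ̃_□(x)Q_{j,μ}(ηA, x)` -/

section Eq416

variable {d N : ℕ} [NeZero N] {𝔤 : Type*} [NormedAddCommGroup 𝔤] [NormedSpace ℝ 𝔤]

/-- The space of (𝔤-valued, vector) fields `A = (A_λ(x′))` on the fine torus `T_ξ`, with the sup norm.
[cite: Balaban1987RG1, (4.16) p.285] -/
abbrev Fld (d N : ℕ) [NeZero N] (𝔤 : Type*) [NormedAddCommGroup 𝔤] [NormedSpace ℝ 𝔤] : Type _ :=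
  (Fin d → ZMod N) → Fin d → 𝔤

/-- `t_a(ηA) = η(t_aA)`. [folklore] -/
private theorem transl_smul (a : Fin d → ZMod N) (η : ℝ) (A : Fld d N 𝔤) :
    transl a (η • A) = η • transl a A := rfl

/-- **The localized field** `B_μ(x) = ζ̃_□(x)Q_{j,μ}(ηA, x)` on the unit lattice (`Q = Q_{j,μ}` for fixed `j, μ`).
[cite: Balaban1987RG1, (4.16) p.285] -/
def Bfield (ζ : (Fin d → ZMod N) → ℝ) (Q : Fld d N 𝔤 → (Fin d → ZMod N) → 𝔤) (η : ℝ) (A : Fld d N 𝔤)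
    (x : Fin d → ZMod N) : 𝔤 :=
  ζ x • Q (η • A) x

/-- **The unit-lattice derivative** `(∂_νB_μ)(x) = B_μ(x + e_ν) − B_μ(x)`.
[cite: Balaban1987RG1, (4.16) p.285] -/
def dB (ζ : (Fin d → ZMod N) → ℝ) (Q : Fld d N 𝔤 → (Fin d → ZMod N) → 𝔤) (η : ℝ) (A : Fld d N 𝔤)
    (n : ℕ) (ν : Fin d) (x : Fin d → ZMod N) : 𝔤 :=
  Bfield ζ Q η A (x + unitStep n ν) - Bfield ζ Q η A x

/-- **(4.16)** (first display, the formula for `∂_νB_μ`): for `Q_{j,μ}` translation invariant under the unit step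
and of class `C¹` in the field on an open set containing the segment `ηA + tη(t_{e_ν}A − A)`, `t ∈ [0,1]`,
`(∂_νB_μ)(x) = Σ_{b⊂[x,x+e_ν]} ξ(∂^ξζ̃_□)(b)·Q_{j,μ}(ηA, x+e_ν)
   + ζ̃_□(x)∫₀¹dt ⟨(δ/δA)Q_{j,μ}(ηA + ηt(t_{e_ν}A − A)), η(t_{e_ν}A − A)⟩`.
[cite: Balaban1987RG1, (4.16) p.285] -/
theorem eq416 [CompleteSpace 𝔤] (ζ : (Fin d → ZMod N) → ℝ) (Q : Fld d N 𝔤 → (Fin d → ZMod N) → 𝔤) (η : ℝ)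
    (A : Fld d N 𝔤) {n : ℕ} {ν : Fin d} {x : Fin d → ZMod N} {ξ : ℝ} (hξ : ξ ≠ 0)
    (htransl : ∀ A' : Fld d N 𝔤, Q A' (x + unitStep n ν) = Q (transl (unitStep n ν) A') x)
    {s : Set (Fld d N 𝔤)} (hs : IsOpen s) (hQ : ContDiffOn ℝ 1 (fun A' => Q A' x) s)
    (hseg : ∀ t ∈ Icc (0 : ℝ) 1, η • A + t • (η • (transl (unitStep n ν) A - A)) ∈ s) :
    dB ζ Q η A n ν x =
      (∑ m ∈ range n, ξ • dxi ξ ζ x ν m) • Q (η • A) (x + unitStep n ν)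
        + ζ x • ∫ t in (0 : ℝ)..1,
            fderiv ℝ (fun A' => Q A' x) (η • A + t • (η • (transl (unitStep n ν) A - A)))
              (η • (transl (unitStep n ν) A - A)) := by
  -- product rule
  have hsplit : dB ζ Q η A n ν x = (ζ (x + unitStep n ν) - ζ x) • Q (η • A) (x + unitStep n ν)
      + ζ x • (Q (η • A) (x + unitStep n ν) - Q (η • A) x) := by
    simp only [dB, Bfield, sub_smul, smul_sub]
    abel
  -- translation invariance and the FTC along `ηA + t·η(t_{e_ν}A − A)`
  have hQt : Q (η • A) (x + unitStep n ν) = Q (η • A + η • (transl (unitStep n ν) A - A)) x := by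
    rw [htransl, transl_smul, smul_sub, add_sub_cancel]
  have hftc := ftc_segment hs hQ (η • A) (η • (transl (unitStep n ν) A - A)) hseg
  rw [hsplit, sub_eq_sum_xi_dxi hξ ζ x ν n, hQt, hftc]

end Eq416

/-! ## §4. (4.17): the first-derivative bound, from the printed inputs -/

section Eq417

variable {d N : ℕ} [NeZero N] {𝔤 : Type*} [NormedAddCommGroup 𝔤] [NormedSpace ℝ 𝔤] [CompleteSpace 𝔤]

/-- **(4.17), as the arithmetic it asserts.**  Inputs, each a NAMED hypothesis (the print cites (3.32) and
Proposition 5 of [7] for them): `hvar` — the total `ξ`-variation of `ζ̃_□` along `[x, x+e_ν]` is `≤ cζ`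
(*«The same remark applies to the derivative ∂^ξζ̃_□»*); `hQ0` — `|Q_{j,μ}(ηA, x+e_ν)| ≤ q`; `hζ` — `|ζ̃_□(x)| ≤ 1`;
`hD` — `‖(δ/δA)Q_{j,μ}‖ ≤ D` on the segment (*«Proposition 5 [7] on functional derivatives of averaging
operations»*); `ha` — `|η(t_{e_ν}A − A)| ≤ a` (*«∂^ξA_λ can be bounded by O(1)L^jη»*, (3.32), via `eq416_transl`).
Conclusion: `|(∂_νB_μ)(x)| ≤ cζ·q + D·a`; in print the right side is `O(1)(α₂ + B₃O(1)Mα₀)(L^jη)² < α₁(L^jη)²`.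
[cite: Balaban1987RG1, (4.17) p.285] -/
theorem norm_dB_le (ζ : (Fin d → ZMod N) → ℝ) (Q : Fld d N 𝔤 → (Fin d → ZMod N) → 𝔤) (η : ℝ)
    (A : Fld d N 𝔤) {n : ℕ} {ν : Fin d} {x : Fin d → ZMod N} {ξ : ℝ} (hξ : ξ ≠ 0)
    (htransl : ∀ A' : Fld d N 𝔤, Q A' (x + unitStep n ν) = Q (transl (unitStep n ν) A') x)
    {s : Set (Fld d N 𝔤)} (hs : IsOpen s) (hQ : ContDiffOn ℝ 1 (fun A' => Q A' x) s)
    (hseg : ∀ t ∈ Icc (0 : ℝ) 1, η • A + t • (η • (transl (unitStep n ν) A - A)) ∈ s)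
    {cζ q D a : ℝ} (hvar : ∑ m ∈ range n, ‖ξ • dxi ξ ζ x ν m‖ ≤ cζ)
    (hQ0 : ‖Q (η • A) (x + unitStep n ν)‖ ≤ q) (hζ : |ζ x| ≤ 1) (hDnn : 0 ≤ D)
    (hD : ∀ t ∈ Icc (0 : ℝ) 1,
      ‖fderiv ℝ (fun A' => Q A' x) (η • A + t • (η • (transl (unitStep n ν) A - A)))‖ ≤ D)
    (ha : ‖η • (transl (unitStep n ν) A - A)‖ ≤ a) :
    ‖dB ζ Q η A n ν x‖ ≤ cζ * q + D * a := by
  set v : Fld d N 𝔤 := η • (transl (unitStep n ν) A - A) with hv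
  rw [eq416 ζ Q η A hξ htransl hs hQ hseg]
  have hq0 : 0 ≤ q := le_trans (norm_nonneg _) hQ0
  have ha0 : 0 ≤ a := le_trans (norm_nonneg _) ha
  -- first term
  have h1 : ‖(∑ m ∈ range n, ξ • dxi ξ ζ x ν m) • Q (η • A) (x + unitStep n ν)‖ ≤ cζ * q := by
    rw [norm_smul]
    have hs' : ‖∑ m ∈ range n, ξ • dxi ξ ζ x ν m‖ ≤ cζ := le_trans (norm_sum_le _ _) hvar
    exact mul_le_mul hs' hQ0 (norm_nonneg _) (le_trans (norm_nonneg _) hs')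
  -- second term
  have hint : ‖∫ t in (0 : ℝ)..1, fderiv ℝ (fun A' => Q A' x) (η • A + t • v) v‖ ≤ D * a := by
    have hb : ∀ t ∈ Set.uIoc (0 : ℝ) 1, ‖fderiv ℝ (fun A' => Q A' x) (η • A + t • v) v‖ ≤ D * a := by
      intro t ht
      have ht' : t ∈ Icc (0 : ℝ) 1 := by
        rw [Set.uIoc_of_le zero_le_one] at ht
        exact ⟨ht.1.le, ht.2⟩
      calc ‖fderiv ℝ (fun A' => Q A' x) (η • A + t • v) v‖
          ≤ ‖fderiv ℝ (fun A' => Q A' x) (η • A + t • v)‖ * ‖v‖ := ContinuousLinearMap.le_opNorm _ _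
        _ ≤ D * a := mul_le_mul (hD t ht') ha (norm_nonneg _) hDnn
    have := intervalIntegral.norm_integral_le_of_norm_le_const hb
    simpa using this
  have h2 : ‖ζ x • ∫ t in (0 : ℝ)..1, fderiv ℝ (fun A' => Q A' x) (η • A + t • v) v‖ ≤ D * a := by
    rw [norm_smul, Real.norm_eq_abs]
    calc |ζ x| * ‖∫ t in (0 : ℝ)..1, fderiv ℝ (fun A' => Q A' x) (η • A + t • v) v‖
        ≤ 1 * (D * a) := mul_le_mul hζ hint (norm_nonneg _) zero_le_one
      _ = D * a := one_mul _
  exact le_trans (norm_add_le _ _) (add_le_add h1 h2)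

end Eq417

end

end Literature.MathematicalPhysics.QuantumFieldTheory.Balaban1983to89.B12Eq416DerivB
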